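import Mathlib
import Summits.BirchSwinnertonDyer.BirchSwinnertonDyer.Theorems.ResidualThetaTransportAtTwoLambdaLowerBoundOExact

/-!
# Sketch (stub-ideation k2 g18): the (i)-half ADAPTER for S3′ of line `onepair` —
# «an ERL-shaped column identity `e (𝒸 (r • z)) = r · h` ⇒ `colocdQuot z ≃ Λ_𝒪 ⧸ (h)` ⇒ (nz⁺) ∧ (i_D)»

Crux (R≥)ᵖ `ResidualThetaCountLowerPureAtTwo` (stmt-BirchSwinnertonDyer-26074), stub `stub_cmLambdaLower`
(= RSL_g, stmt-BirchSwinnertonDyer-22608), registered line `Cruxes/ResidualSignedLambdaLowerCMAtTwo/Lines/onepair.lean`,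
PRINT-HOLD stub S3′ `stub_katoZetaCMAtTwo`, clauses (nz⁺) ∧ (i_D).  PURE ALGEBRA (Mathlib + the landed
`…LambdaLowerBoundOExact`); no curve, no Galois cohomology; nothing here is proposed to `Theorems/`;
BSD is NOT proved by any of this, nor is 26074 / 22608 / S3′.

Dictionary for the intended instantiation (route `ResidualThetaTransportAtTwo`, `OnePairPins π`):
`Λ₀ := ℤ₂⟦X⟧ = PowerSeries ℤ_[2]`, `Λ := Λ_𝒪 = IwasawaAlgebraO S`, `R := ℤ_[2]`, `F := ℚ_[2]`, `A := 𝒪 = coeffO S`,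
`K := Frac 𝒪`, `H := I.H` (Kato's `𝐇¹`), `P := Fin n → ℤ₂⟦X⟧`, `c := π.cvec`, `h := D * (L⁻_g * u)`,
`e` := an ERL-adapted `Λ₀`-linear trivialisation `ℤ₂⟦X⟧ⁿ ≃ Λ_𝒪` (rank `n = f = [𝒪 : ℤ₂]`).
-/

set_option autoImplicit false
-- the Cruxes namespace of this sub repeats the summit name by design (D-0017 nested layout)
set_option linter.dupNamespace false

noncomputable section

open scoped TensorProduct

namespace Summit.BirchSwinnertonDyer.BirchSwinnertonDyer.Cruxes.ResidualThetaCountLowerPureAtTwo.SideaK2G18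

open Summit.BirchSwinnertonDyer.BirchSwinnertonDyer.Theorems

/-! ## §1 The Coleman quotient along an ERL-shaped column identity: `P ⧸ span_{Λ₀} c(Λ z) ≃ₗ[Λ₀] Λ ⧸ (h)` -/

section ColQuot

variable {Λ₀ : Type*} [CommRing Λ₀] {Λ : Type*} [CommRing Λ] [Algebra Λ₀ Λ]
  {H : Type*} [AddCommGroup H] [Module Λ H]
  {P : Type*} [AddCommGroup P] [Module Λ₀ P]

/-- (H1) Under an `Λ₀`-linear trivialisation `e : P ≃ Λ` with `e (c (r • z)) = r * h` for all `r : Λ`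
(the ERL-shaped column identity; `c` is a bare function — no linearity of `c` is assumed), the
`Λ₀`-span of `c(Λ • z)` is carried onto the principal ideal `(h)`. -/
theorem map_span_image_eq (c : H → P) (z : H) (h : Λ) (e : P ≃ₗ[Λ₀] Λ)
    (he : ∀ r : Λ, e (c (r • z)) = r * h) :
    (Submodule.span Λ₀ (c '' (↑(Submodule.span Λ ({z} : Set H)) : Set H))).map (e : P →ₗ[Λ₀] Λ) =
      (Ideal.span ({h} : Set Λ)).restrictScalars Λ₀ := by
  apply le_antisymm
  · rw [Submodule.map_span, Submodule.span_le]
    rintro x ⟨y, ⟨w, hw, rfl⟩, rfl⟩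
    obtain ⟨r, rfl⟩ := Submodule.mem_span_singleton.mp hw
    simp only [SetLike.mem_coe, Submodule.restrictScalars_mem, LinearEquiv.coe_coe, he]
    exact Ideal.mem_span_singleton'.mpr ⟨r, rfl⟩
  · intro x hx
    rw [Submodule.restrictScalars_mem] at hx
    obtain ⟨r, rfl⟩ := Ideal.mem_span_singleton'.mp hx
    rw [Submodule.map_span]
    refine Submodule.subset_span ⟨c (r • z), ⟨r • z, ?_, rfl⟩, ?_⟩
    · exact Submodule.mem_span_singleton.mpr ⟨r, rfl⟩
    · simp [he]

/-- (H2) **The Coleman-quotient trivialisation.** `P ⧸ span_{Λ₀} c(Λ•z) ≃ₗ[Λ₀] Λ ⧸ (h)`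
(for RTT: `colocdQuot z ≃ₗ[ℤ₂⟦X⟧] Λ_𝒪 ⧸ (D · L⁻_g · u)`). -/
def colQuotEquiv (c : H → P) (z : H) (h : Λ) (e : P ≃ₗ[Λ₀] Λ)
    (he : ∀ r : Λ, e (c (r • z)) = r * h) :
    (P ⧸ Submodule.span Λ₀ (c '' (↑(Submodule.span Λ ({z} : Set H)) : Set H))) ≃ₗ[Λ₀]
      (Λ ⧸ Ideal.span ({h} : Set Λ)) :=
  (Submodule.Quotient.equiv _ _ e (map_span_image_eq c z h e he)).trans
    (Submodule.Quotient.restrictScalarsEquiv Λ₀ (Ideal.span ({h} : Set Λ)))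

end ColQuot

/-! ## §2 `λ`-currency is invariant under linear isomorphism (finiteness and rank of `F ⊗_R ·`) -/

section RankTransfer

variable {R : Type*} [CommRing R] (F : Type*) [CommRing F] [Algebra R F]
  {M N : Type*} [AddCommGroup M] [Module R M] [AddCommGroup N] [Module R N]

/-- (H3a) finiteness of `F ⊗_R ·` transfers along `M ≃ₗ[R] N`. -/
theorem finite_baseChange_of_equiv (E : M ≃ₗ[R] N) [Module.Finite F (F ⊗[R] N)] :
    Module.Finite F (F ⊗[R] M) :=
  Module.Finite.equiv (LinearEquiv.baseChange R F M N E).symm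

/-- (H3b) `dim_F (F ⊗_R M) = dim_F (F ⊗_R N)` along `M ≃ₗ[R] N`. -/
theorem finrank_baseChange_eq_of_equiv (E : M ≃ₗ[R] N) :
    Module.finrank F (F ⊗[R] M) = Module.finrank F (F ⊗[R] N) :=
  (LinearEquiv.baseChange R F M N E).finrank_eq

end RankTransfer

/-! ## §3 The (i)-half adapter: (nz⁺) and the `λ_{ℤ₂}`-identity for the Coleman quotient -/

section Adapter

variable {R : Type*} [CommRing R] (F : Type*) [CommRing F] [Algebra R F]
  {Λ₀ : Type*} [CommRing Λ₀] [Algebra R Λ₀]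
  {Λ : Type*} [CommRing Λ] [Algebra Λ₀ Λ] [Algebra R Λ] [IsScalarTower R Λ₀ Λ]
  {H : Type*} [AddCommGroup H] [Module Λ H]
  {P : Type*} [AddCommGroup P] [Module Λ₀ P] [Module R P] [IsScalarTower R Λ₀ P]

/-- (H4) **(nz⁺) ∧ (i)-identity from the column identity.** If `F ⊗_R Λ⧸(h)` is finite (for RTT: `h ≠ 0` in the
domain `Λ_𝒪`, `…LambdaAssembly.finite_baseChange_of_isTorsion` + `IntDescent.finite_baseChange_iff`), then
`F ⊗_R (P ⧸ span c(Λz))` is finite — clause (nz⁺) — and has the same `F`-rank as `F ⊗_R Λ⧸(h)`. -/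
theorem i_clauses_of_colIdentity (c : H → P) (z : H) (h : Λ) (e : P ≃ₗ[Λ₀] Λ)
    (he : ∀ r : Λ, e (c (r • z)) = r * h)
    [Module.Finite F (F ⊗[R] (Λ ⧸ Ideal.span ({h} : Set Λ)))] :
    Module.Finite F (F ⊗[R] (P ⧸ Submodule.span Λ₀ (c '' (↑(Submodule.span Λ ({z} : Set H)) : Set H)))) ∧
      Module.finrank F (F ⊗[R] (P ⧸ Submodule.span Λ₀ (c '' (↑(Submodule.span Λ ({z} : Set H)) : Set H)))) =
        Module.finrank F (F ⊗[R] (Λ ⧸ Ideal.span ({h} : Set Λ))) := by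
  let E := (colQuotEquiv c z h e he).restrictScalars R
  exact ⟨finite_baseChange_of_equiv F E, finrank_baseChange_eq_of_equiv F E⟩

end Adapter

/-! ## §4 `λ` of a principal quotient is additive in the generator: `λ(Λ⧸(D h)) = λ(Λ⧸(h)) + λ(Λ⧸(D))` -/

section Additivity

variable {A : Type*} [CommRing A] (K : Type*) [Field K] [Algebra A K] [IsFractionRing A K]
  {Λ : Type*} [CommRing Λ] [IsDomain Λ] [Algebra A Λ]

/-- multiplication by `D`: `Λ⧸(h) → Λ⧸(D h)`. -/
def mulQuot (D h : Λ) : (Λ ⧸ Ideal.span ({h} : Set Λ)) →ₗ[Λ] (Λ ⧸ Ideal.span ({D * h} : Set Λ)) :=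
  Submodule.mapQ _ _ (LinearMap.mulLeft Λ D) (fun x hx => Submodule.mem_comap.mpr (by
    obtain ⟨a, rfl⟩ := Ideal.mem_span_singleton'.mp hx
    rw [LinearMap.mulLeft_apply]
    exact Ideal.mem_span_singleton'.mpr ⟨a, by ring⟩))

/-- the factor map `Λ⧸(D h) → Λ⧸(D)`. -/
def factorQuot (D h : Λ) : (Λ ⧸ Ideal.span ({D * h} : Set Λ)) →ₗ[Λ] (Λ ⧸ Ideal.span ({D} : Set Λ)) :=
  Submodule.mapQ _ _ LinearMap.id (fun x hx => Submodule.mem_comap.mpr (by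
    obtain ⟨a, rfl⟩ := Ideal.mem_span_singleton'.mp hx
    rw [LinearMap.id_apply]
    exact Ideal.mem_span_singleton'.mpr ⟨a * h, by ring⟩))

omit [IsDomain Λ] [Algebra A Λ] in
theorem mulQuot_mk (D h x : Λ) :
    mulQuot D h (Submodule.Quotient.mk x) = Submodule.Quotient.mk (D * x) := rfl

omit [IsDomain Λ] [Algebra A Λ] in
theorem factorQuot_mk (D h x : Λ) :
    factorQuot D h (Submodule.Quotient.mk x) = Submodule.Quotient.mk x := rfl

omit [Algebra A Λ] in
theorem mulQuot_injective (D h : Λ) (hD : D ≠ 0) : Function.Injective (mulQuot D h) := by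
  rw [injective_iff_map_eq_zero]
  intro x hx
  obtain ⟨x, rfl⟩ := Submodule.Quotient.mk_surjective _ x
  rw [mulQuot_mk, Submodule.Quotient.mk_eq_zero] at hx
  obtain ⟨a, ha⟩ := Ideal.mem_span_singleton'.mp hx
  rw [Submodule.Quotient.mk_eq_zero]
  exact Ideal.mem_span_singleton'.mpr ⟨a, mul_left_cancel₀ hD (by linear_combination ha)⟩

omit [IsDomain Λ] [Algebra A Λ] in
theorem exact_mulQuot_factorQuot (D h : Λ) : Function.Exact (mulQuot D h) (factorQuot D h) := by
  intro y
  obtain ⟨y, rfl⟩ := Submodule.Quotient.mk_surjective _ y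
  constructor
  · intro hy
    rw [factorQuot_mk, Submodule.Quotient.mk_eq_zero] at hy
    obtain ⟨a, rfl⟩ := Ideal.mem_span_singleton'.mp hy
    exact ⟨Submodule.Quotient.mk a, by rw [mulQuot_mk, mul_comm D a]⟩
  · rintro ⟨x, hx⟩
    obtain ⟨x, rfl⟩ := Submodule.Quotient.mk_surjective _ x
    rw [← hx, mulQuot_mk, factorQuot_mk, Submodule.Quotient.mk_eq_zero]
    exact Ideal.mem_span_singleton'.mpr ⟨x, mul_comm x D⟩

omit [IsDomain Λ] [Algebra A Λ] in
theorem factorQuot_surjective (D h : Λ) : Function.Surjective (factorQuot D h) := by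
  intro y
  obtain ⟨y, rfl⟩ := Submodule.Quotient.mk_surjective _ y
  exact ⟨Submodule.Quotient.mk y, rfl⟩

/-- (H5) **`λ(Λ⧸(D h)) = λ(Λ⧸(h)) + λ(Λ⧸(D))`** for `D ≠ 0` in a domain `Λ` which is an `A`-algebra, `λ = dim_K (K ⊗_A ·)`,
`K = Frac A` flat: the short exact sequence `0 → Λ⧸(h) →[·D] Λ⧸(D h) → Λ⧸(D) → 0` and
`LambdaLowerBoundO.finrank_baseChange_eq_of_exact_three`. -/
theorem finrank_quot_mul_eq_add (D h : Λ) (hD : D ≠ 0)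
    [Module.Finite K (K ⊗[A] (Λ ⧸ Ideal.span ({D * h} : Set Λ)))] :
    Module.finrank K (K ⊗[A] (Λ ⧸ Ideal.span ({D * h} : Set Λ))) =
      Module.finrank K (K ⊗[A] (Λ ⧸ Ideal.span ({h} : Set Λ))) +
        Module.finrank K (K ⊗[A] (Λ ⧸ Ideal.span ({D} : Set Λ))) :=
  LambdaLowerBoundO.finrank_baseChange_eq_of_exact_three K
    ((mulQuot D h).restrictScalars A) ((factorQuot D h).restrictScalars A)
    (mulQuot_injective D h hD) (exact_mulQuot_factorQuot D h) (factorQuot_surjective D h)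

/-- (H6) **The (i_D) count on the `𝒪`-side.** With `h = D · (L · u)`, `D, L ≠ 0`, `λ(Λ⧸(L)) = d`:
`d + λ(Λ⧸(D)) ≤ λ(Λ⧸(D · (L · u)))` (the slack is `λ(Λ⧸(u)) ≥ 0`). -/
theorem iD_count (D L u : Λ) (hD : D ≠ 0) (hL : L ≠ 0) (d : ℕ)
    (hd : Module.finrank K (K ⊗[A] (Λ ⧸ Ideal.span ({L} : Set Λ))) = d)
    [Module.Finite K (K ⊗[A] (Λ ⧸ Ideal.span ({D * (L * u)} : Set Λ)))]
    [Module.Finite K (K ⊗[A] (Λ ⧸ Ideal.span ({L * u} : Set Λ)))] :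
    d + Module.finrank K (K ⊗[A] (Λ ⧸ Ideal.span ({D} : Set Λ))) ≤
      Module.finrank K (K ⊗[A] (Λ ⧸ Ideal.span ({D * (L * u)} : Set Λ))) := by
  rw [finrank_quot_mul_eq_add K D (L * u) hD, finrank_quot_mul_eq_add K L u hL, ← hd]
  omega

end Additivity

/-! ## §5 Assembly of (i_D) in the two currencies (pure bookkeeping) -/

/-- (H7) `λ_{ℤ₂}(colocdQuot z) = f · λ_𝒪(Λ_𝒪⧸(h))` (H4 + `IntDescent.finrank_baseChange_eq_mul`) and
`d + λ_𝒪(Λ_𝒪⧸(D)) ≤ λ_𝒪(Λ_𝒪⧸(h))` (H6) give clause (i_D) `f · (d + λ_𝒪(Λ_𝒪⧸(D))) ≤ λ_{ℤ₂}(colocdQuot z)`. -/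
theorem iD_of_currency (f d lamT lamOh lamD : ℕ) (hdesc : lamT = f * lamOh) (hcount : d + lamD ≤ lamOh) :
    f * (d + lamD) ≤ lamT := by
  subst hdesc
  exact Nat.mul_le_mul_left f hcount

end Summit.BirchSwinnertonDyer.BirchSwinnertonDyer.Cruxes.ResidualThetaCountLowerPureAtTwo.SideaK2G18

end
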